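import Mathlib
import Literature.MathematicalPhysics.QuantumFieldTheory.CurvatureGaussianField
import Summits.QuantumFields.YangMills.Theses.EquipartitionCriticality

/-!
# Sketch — first lemmas of three crux ideas for `EquipartitionPinsProbe` (stmt-QuantumFields-8760)

crux-ideate round 1, ideator 1.  Each `def … : Prop` below is the FIRST CHECKABLE STATEMENT of one
idea card (it must elaborate; it is not proved here).

* `SDRigidityAtMomentum`      — card `sd-bochner-covariance-rigidity` (pointwise-in-momentum core of
  the rigidity lemma: the Schwinger–Dyson covariance equation `K d₁ = d₁`, closedness `d₂ K = 0`
  and exactness `ker d₂ = ran d₁` force a self-adjoint `K` to be the orthogonal projector onto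
  exact = closed 2-forms; no positivity needed at `k ≠ 0`).
* `BudgetStarvesZeroMode`, `StationaryCouplingBound` — card `stationary-langevin-coupling`
  (the step where the hypothesis H = log-coefficient budget is spent: an independent zero mode `c`
  added to the free field cannot fit under the equipartition budget; and the telescoping L¹ bound
  that stationarity buys for a synchronous coupling with a contraction).
* `ProbeProfileSecondDifference`, `ProbeProfileKallenLehmann`, `ProbeProfilePositive`,
  `ProbeProfileSubexponential` — card `photon-kallen-lehmann-positivity` (clause (iii) of the crux:
  `c_n > 0` for every `n ≠ 0` and `c_n ≥ C_ε e^{-ε|n|}`, from the mixed time/momentum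
  representation of the axis lattice Green function of `ℤ⁴`).
-/

namespace Summit.QuantumFields.YangMills.Cruxes.EquipartitionPinsProbe.IdeaSketch

open scoped InnerProductSpace
open MeasureTheory ProbabilityTheory
open Literature.Probability.LatticeModels Literature.MathematicalPhysics.QuantumFieldTheory

-- the crux this sketch sits under (type-checks by name)
example : Prop := Summit.QuantumFields.YangMills.Theses.EquipartitionCriticality.EquipartitionPinsProbe

/-! ## Card 1 — `sd-bochner-covariance-rigidity` -/

/-- Pointwise (fixed momentum `k ≠ 0`) core of the rigidity lemma.  `V` = 2-forms ⊗ 𝔤_ℂ at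
momentum `k`, `W` = 1-forms, `Z` = 3-forms, `d₁ = d̂₁(k)`, `d₂ = d̂₂(k)`; exactness of the twisted
(Koszul) lattice de Rham complex at `k ≠ 0` is the hypothesis `ker d₂ = range d₁`.  Conclusion: the
absolutely continuous part of the curvature spectral matrix is the Maxwell projector. -/
def SDRigidityAtMomentum : Prop :=
  ∀ {V W Z : Type} [NormedAddCommGroup V] [InnerProductSpace ℂ V] [FiniteDimensional ℂ V]
    [AddCommGroup W] [Module ℂ W] [AddCommGroup Z] [Module ℂ Z]
    (K : V →ₗ[ℂ] V) (d₁ : W →ₗ[ℂ] V) (d₂ : V →ₗ[ℂ] Z),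
    (∀ u v : V, ⟪K u, v⟫_ℂ = ⟪u, K v⟫_ℂ) →
    K ∘ₗ d₁ = d₁ → d₂ ∘ₗ K = 0 → LinearMap.ker d₂ = LinearMap.range d₁ →
    ∀ v : V, K v = (LinearMap.range d₁).starProjection v

/-! ## Card 2 — `stationary-langevin-coupling` -/

/-- The budget step (where H is spent): if `c ⟂ Y` (independent), `Y` centred, both square
integrable in `ℝ^D`, and `E‖c + Y‖² ≤ E‖Y‖²` (Fatou + equipartition budget), then `c = 0` a.s. -/
def BudgetStarvesZeroMode : Prop :=
  ∀ {Ω : Type} [MeasurableSpace Ω] (P : Measure Ω) [IsProbabilityMeasure P] {D : ℕ}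
    (c Y : Ω → EuclideanSpace ℝ (Fin D)),
    AEMeasurable c P → AEMeasurable Y P → IndepFun c Y P →
    MemLp c 2 P → MemLp Y 2 P → (∫ ω, Y ω ∂P) = 0 →
    (∫ ω, ‖c ω + Y ω‖ ^ 2 ∂P) ≤ (∫ ω, ‖Y ω‖ ^ 2 ∂P) →
    c =ᵐ[P] 0

/-- The linear shadow `y` of a perturbed linear recursion driven by the same noise:
`y₀ = x₀`, `y_{t+1} = Φ y_t + ξ_t`. -/
def linearShadow {E Ω : Type} [AddCommGroup E] [Module ℝ E] (Φ : E →ₗ[ℝ] E) (ξ : ℕ → Ω → E)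
    (x₀ : Ω → E) : ℕ → Ω → E
  | 0 => x₀
  | t + 1 => fun ω => Φ (linearShadow Φ ξ x₀ t ω) + ξ t ω

/-- Stationary synchronous coupling, discrete-time skeleton: if `x_{t+1} = Φ x_t + N(x_t) + ξ_t`
with `‖Φ‖ ≤ 1` and the nonlinearity is small in `L¹` AT EVERY TIME (this is what stationarity of the
law of `x_t` buys from a single one-time moment bound), then `x_T` is `Tε`-close in `L¹` to its
linear shadow driven by the same noise from the same initial datum. -/
def StationaryCouplingBound : Prop :=
  ∀ {E : Type} [NormedAddCommGroup E] [NormedSpace ℝ E] {Ω : Type} [MeasurableSpace Ω]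
    (P : Measure Ω) [IsProbabilityMeasure P] (Φ : E →L[ℝ] E) (x ξ : ℕ → Ω → E) (N : E → E) (ε : ℝ),
    ‖Φ‖ ≤ 1 →
    (∀ t ω, x (t + 1) ω = Φ (x t ω) + N (x t ω) + ξ t ω) →
    (∀ t, Integrable (fun ω => N (x t ω)) P) →
    (∀ t, ∫ ω, ‖N (x t ω)‖ ∂P ≤ ε) →
    (∀ t, AEStronglyMeasurable (x t) P) → (∀ t, AEStronglyMeasurable (ξ t) P) →
    ∀ T : ℕ, ∫ ω, ‖x T ω - linearShadow (Φ : E →ₗ[ℝ] E) ξ (x 0) T ω‖ ∂P ≤ T * ε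

/-! ## Card 3 — `photon-kallen-lehmann-positivity` -/

/-- `4 ≥ 3`. -/
theorem three_le_four : 3 ≤ 4 := by norm_num

/-- The free lattice photon energy at spatial momentum `k ∈ [-π,π]³`:
`cosh ω(k) = 1 + ε(k)`, `ε(k) = ∑ⱼ (1 - cos kⱼ)` (tree `dispersion`), i.e.
`ω = log(1 + ε + √(ε(ε+2)))`. -/
noncomputable def photonEnergy (k : Fin 3 → ℝ) : ℝ :=
  Real.log (1 + dispersion k + Real.sqrt (dispersion k * (dispersion k + 2)))

/-- Step 1 (pure lattice calculus + hypercubic symmetry + `(-Δ)G₀ = δ`): along the `e₀` axis the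
plaquette two-point number is a second difference of the axis Green function,
`c_n = (2/3) Δ₀ G₀(n e₀) = (1/3) Δ₀ latticeGreen(n e₀)` (`G₀ = latticeGreen/2`), `n ≠ 0`. -/
def ProbeProfileSecondDifference : Prop :=
  ∀ n : ℤ, n ≠ 0 →
    curvaturePlaquetteCorr (d := 4) three_le_four n =
      (1 / 3 : ℝ) * (latticeGreen (d := 4) (Pi.single 0 (n + 1)) + latticeGreen (d := 4) (Pi.single 0 (n - 1))
        - 2 * latticeGreen (d := 4) (Pi.single 0 n))

/-- Step 2 (mixed time/momentum = transfer-matrix representation of the axis Green function,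
`G₀(n, k) = e^{-ω|n|}/(2 sinh ω)`): the Källén–Lehmann form of the probe profile with MANIFESTLY
POSITIVE spectral weight `tanh(ω/2)`. -/
def ProbeProfileKallenLehmann : Prop :=
  ∀ n : ℤ, n ≠ 0 →
    curvaturePlaquetteCorr (d := 4) three_le_four n =
      (2 / 3 : ℝ) * (∫ k in brillouin 3,
        Real.exp (-(photonEnergy k * |(n : ℝ)|)) * Real.tanh (photonEnergy k / 2)) / (2 * Real.pi) ^ 3

/-- Consequence 1: `c_n > 0` for every `n ≠ 0` (so `g(n) > 0` for the probe `φ = e^{-λ·}`, whose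
profile `g(n) = ((1+λ/2)² - λ²c_n²)^{-D/2} - (1+λ/2)^{-D}` is increasing in `c_n²`). -/
def ProbeProfilePositive : Prop :=
  ∀ n : ℤ, n ≠ 0 → 0 < curvaturePlaquetteCorr (d := 4) three_le_four n

/-- Consequence 2: sub-exponential decay — for every rate `ε > 0` the profile eventually beats
`e^{-ε|n|}` (restrict the KL integral to `{ω(k) ≤ ε}`, a set of positive measure); this is exactly
the `g`-clause `∀ m > 0 ∃ s < t, …` of the crux. -/
def ProbeProfileSubexponential : Prop :=
  ∀ ε : ℝ, 0 < ε → ∃ C : ℝ, 0 < C ∧ ∀ n : ℤ, n ≠ 0 →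
    C * Real.exp (-(ε * |(n : ℝ)|)) ≤ curvaturePlaquetteCorr (d := 4) three_le_four n

end Summit.QuantumFields.YangMills.Cruxes.EquipartitionPinsProbe.IdeaSketch
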